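import Literature.NumberTheory.Transcendental.HeightLocalGlobal
import HarnessLib

/-!
# Local estimates for `t = 1/r + r^{m'}/s` on `r^e = x(1-x)`, II: arbitrary absolute values

Companion of `SuperellipticHeightsLocal.lean` ([GenEll] = S. Mochizuki, *Arithmetic elliptic curves in
general position*, Math. J. Okayama Univ. 52 (2010), Prop. 1.4 (i); abc-iut cell, route item
`Summit.ABC.ABC.Theses.IUTThetaPilot.GenEllTwo`, S6's plan GENELLTWO-P1ROUTE §3(b), package W4a): the
same local comparisons for an ARBITRARY absolute value `v` (used at the archimedean places), now with
explicit constants — `X = v x`, `S = v(1 - 2x)`, `T = v(r^{m'}/s)`, `D = max(v 2⁻¹, 1)`: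

* `tPart_upper` — `max(T,1)^e ≤ 4^e · D^e · max(X,1) · max(S⁻¹,1)^e`;
* `tPart_lower` — `max(X,1) · max(S⁻¹,1)^e ≤ 24^e · max(T,1)^e`;
* `tSum_lower` — `max(v t₁,1) · max(v t₂,1) ≤ 32 · max(v(t₁ + t₂),1)` (`t₁ = 1/r`, `e ≥ 2`).

Only `v(n) ≤ n` for natural numbers and the triangle inequality are used, so the lemmas hold for
every absolute value of an admissible family. Everything is proved; no definitions, no named facts;
classical — nothing here refers to the disputed parts of the abc-iut corpus.
-/

noncomputable section

open Height Finset Real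
open Literature.NumberTheory.Transcendental

namespace Literature.NumberTheory.DiophantineGeometry

namespace Superelliptic

/-! ### Elementary real-number helpers -/

/-- `max(T,1)^e ≤ R` from `T^e ≤ R` and `1 ≤ R`. [folklore] -/
private theorem max_one_pow_le {T R : ℝ} {e : ℕ} (h1 : T ^ e ≤ R) (h2 : 1 ≤ R) :
    max T 1 ^ e ≤ R := by
  rcases le_total T 1 with h | h
  · rw [max_eq_right h, one_pow]; exact h2
  · rw [max_eq_left h]; exact h1

/-- `A ≤ max(T,1)^e` from `A ≤ T^e`. [folklore] -/
private theorem le_max_one_pow {T A : ℝ} {e : ℕ} (hT : 0 ≤ T) (h : A ≤ T ^ e) :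
    A ≤ max T 1 ^ e :=
  h.trans (pow_le_pow_left₀ hT (le_max_left _ _) e)

/-! ### Local analysis -/

section Local

variable {K : Type*} [Field K] (v : AbsoluteValue K ℝ)

/-- `v(x(1-x)) ≥ (1 - v(1-2x)²)/4` for any absolute value: from `4·x(1-x) = 1 - (1-2x)²` (the
Bezout relation `s² + 4r^e = 1` between `s` and `r` on `D_e`) and `v(4) ≤ 4`.
[cite: MochizukiGenEll2010, Thm 2.1 proof p.11] -/
private theorem quarter_le (x : K) : (1 - v (1 - 2 * x) ^ 2) / 4 ≤ v (x * (1 - x)) := by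
  have h1 : v (4 * (x * (1 - x))) = v (1 - (1 - 2 * x) ^ 2) := by
    congr 1; ring
  rw [v.map_mul] at h1
  have h4 : v (4 : K) ≤ 4 := by exact_mod_cast v.apply_nat_le_self 4
  have h2 : 1 - v (1 - 2 * x) ^ 2 ≤ v (1 - (1 - 2 * x) ^ 2) := by
    have := v.le_sub 1 ((1 - 2 * x) ^ 2)
    rwa [v.map_one, v.map_pow] at this
  have h3 : v (4 : K) * v (x * (1 - x)) ≤ 4 * v (x * (1 - x)) :=
    mul_le_mul_of_nonneg_right h4 (v.nonneg _)
  linarith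

variable {e m' : ℕ}

/-- `(v t₂)^e = (v x · v(1-x))^{m'} / (v s)^e` for `t₂ = r^{m'}/s`, `r^e = x(1-x)`, `e + 1 = 2m'`.
[cite: MochizukiGenEll2010, Thm 2.1 proof p.11] -/
private theorem tPart_pow {x r : K} (hr : r ^ e = x * (1 - x)) :
    v (r ^ m' / (1 - 2 * x)) ^ e = (v x * v (1 - x)) ^ m' / v (1 - 2 * x) ^ e := by
  rw [map_div₀, div_pow, v.map_pow, ← pow_mul, mul_comm m' e, pow_mul, ← v.map_pow, hr, v.map_mul]

/-- `(Y·Y)^{m'} = Y^e·Y` when `e + 1 = 2m'`. [folklore] -/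
private theorem mul_self_pow (hem : e + 1 = 2 * m') (Y : ℝ) : (Y * Y) ^ m' = Y ^ e * Y := by
  rw [mul_pow, ← pow_add, ← pow_succ, show m' + m' = e + 1 by omega]

/-- **Upper bound for `t₂ = r^{m'}/s` at an arbitrary absolute value**:
`max(v t₂, 1)^e ≤ 4^e · max(v 2⁻¹, 1)^e · max(v x, 1) · max(v s⁻¹, 1)^e`.
[cite: MochizukiGenEll2010, Prop 1.4 (i) p.6] -/
theorem tPart_upper (hem : e + 1 = 2 * m') (h2 : (2 : K) ≠ 0) {x r : K}
    (hr : r ^ e = x * (1 - x)) (hs : 1 - 2 * x ≠ 0) :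
    max (v (r ^ m' / (1 - 2 * x))) 1 ^ e ≤
      (4 : ℝ) ^ e * (max (v (2 : K)⁻¹) 1 ^ e * max (v x) 1 * max (v (1 - 2 * x)⁻¹) 1 ^ e) := by
  set X := v x with hX
  set S := v (1 - 2 * x) with hS
  set M := max X 1 with hM
  set Dm := max (v (2 : K)⁻¹) 1 with hDdef
  set Q := max (v (1 - 2 * x)⁻¹) 1 with hQ
  have hX0 : 0 ≤ X := v.nonneg _
  have hS0 : 0 < S := v.pos_iff.mpr hs
  have hv2 : 0 < v (2 : K) := v.pos_iff.mpr h2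
  have hv2le : v (2 : K) ≤ 2 := by exact_mod_cast v.apply_nat_le_self 2
  have hDinv : v (2 : K)⁻¹ = (v (2 : K))⁻¹ := map_inv₀ v 2
  have hSinv : v (1 - 2 * x)⁻¹ = S⁻¹ := map_inv₀ v _
  have hM1 : 1 ≤ M := le_max_right _ _
  have hM0 : 0 ≤ M := zero_le_one.trans hM1
  have hXM : X ≤ M := le_max_left _ _
  have hD1 : 1 ≤ Dm := le_max_right _ _
  have hQ1 : 1 ≤ Q := le_max_right _ _
  have hinvD : (v (2 : K))⁻¹ ≤ Dm := by rw [hDdef, hDinv]; exact le_max_left _ _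
  have hSQ : (S ^ e)⁻¹ ≤ Q ^ e := by
    rw [hQ, hSinv, ← inv_pow]; exact pow_le_pow_left₀ (by positivity) (le_max_left _ _) e
  have hm'e : m' ≤ e := by omega
  have hRHS1 : 1 ≤ (4 : ℝ) ^ e * (Dm ^ e * M * Q ^ e) :=
    one_le_mul_of_one_le_of_one_le (one_le_pow₀ (by norm_num))
      (one_le_mul_of_one_le_of_one_le (one_le_mul_of_one_le_of_one_le (one_le_pow₀ hD1) hM1)
        (one_le_pow₀ hQ1))
  have hTe : v (r ^ m' / (1 - 2 * x)) ^ e = (X * v (1 - x)) ^ m' / S ^ e := by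
    rw [hX, hS]; exact tPart_pow v hr
  refine max_one_pow_le ?_ hRHS1
  rw [hTe]
  -- numerator `≤ 2^{m'} M^{e}·M`
  have h1x : v (1 - x) ≤ 2 * M := by
    calc v (1 - x) ≤ v 1 + v x := v.sub_le_add 1 x
      _ = 1 + X := by rw [v.map_one]
      _ ≤ 2 * M := by linarith
  have hnum : (X * v (1 - x)) ^ m' ≤ 2 ^ m' * (M ^ e * M) := by
    have h1 : X * v (1 - x) ≤ 2 * (M * M) := by nlinarith [v.nonneg (1 - x)]
    calc (X * v (1 - x)) ^ m' ≤ (2 * (M * M)) ^ m' := pow_le_pow_left₀ (by positivity) h1 m'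
      _ = 2 ^ m' * (M ^ e * M) := by rw [mul_pow, mul_self_pow hem M]
  have h2m' : (2 : ℝ) ^ m' ≤ 2 ^ e := pow_le_pow_right₀ (by norm_num) hm'e
  have h44 : (4 : ℝ) ^ e = 2 ^ e * 2 ^ e := by rw [← mul_pow]; norm_num
  rcases le_or_gt 2 (v 2 * X) with h2X | h2X
  · -- `v2·X ≥ 2`: `S ≥ v2·X/2`, cancel `X^e`
    have hX1 : 1 ≤ X := by nlinarith
    have hMX : M = X := max_eq_left hX1
    have hSge : v 2 * X / 2 ≤ S := by
      have h := v.le_sub (2 * x) 1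
      rw [v.map_sub (2 * x) 1, v.map_mul, v.map_one] at h
      rw [hS]; linarith
    have hSpos : 0 < v 2 * X / 2 := by positivity
    have hXne : X ≠ 0 := by positivity
    have hv2ne : v (2 : K) ≠ 0 := hv2.ne'
    calc (X * v (1 - x)) ^ m' / S ^ e ≤ 2 ^ m' * (M ^ e * M) / S ^ e :=
          div_le_div_of_nonneg_right hnum (by positivity)
      _ ≤ 2 ^ e * (X ^ e * X) / S ^ e := by
          rw [hMX]; exact div_le_div_of_nonneg_right (by gcongr) (by positivity)
      _ ≤ 2 ^ e * (X ^ e * X) / (v 2 * X / 2) ^ e :=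
          div_le_div_of_nonneg_left (by positivity) (by positivity) (pow_le_pow_left₀ hSpos.le hSge e)
      _ = 4 ^ e * ((v (2 : K))⁻¹ ^ e * X) := by
          rw [div_pow, mul_pow, h44]
          field_simp
          rw [one_div, ← mul_pow, mul_inv_cancel₀ hv2ne, one_pow]
      _ = 4 ^ e * ((v (2 : K))⁻¹ ^ e * X * 1) := by rw [mul_one]
      _ ≤ 4 ^ e * (Dm ^ e * M * Q ^ e) := by
          refine mul_le_mul_of_nonneg_left ?_ (by positivity)
          exact mul_le_mul (mul_le_mul (pow_le_pow_left₀ (by positivity) hinvD e) hXM hX0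
            (by positivity)) (one_le_pow₀ hQ1) zero_le_one (by positivity)
  · -- `v2·X < 2`: `X < 2/v2 ≤ 2·Dm`, so `M ≤ 2·Dm`
    have hM2D : M ≤ 2 * Dm := by
      refine max_le ?_ (by linarith)
      have : X ≤ 2 * (v (2 : K))⁻¹ := by
        rw [inv_eq_one_div, mul_one_div, le_div_iff₀ hv2, mul_comm]; exact h2X.le
      linarith [mul_le_mul_of_nonneg_left hinvD (by norm_num : (0:ℝ) ≤ 2)]
    have hMe : M ^ e ≤ (2 * Dm) ^ e := pow_le_pow_left₀ hM0 hM2D e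
    calc (X * v (1 - x)) ^ m' / S ^ e ≤ 2 ^ m' * (M ^ e * M) / S ^ e :=
          div_le_div_of_nonneg_right hnum (by positivity)
      _ = 2 ^ m' * (M ^ e * M) * (S ^ e)⁻¹ := div_eq_mul_inv _ _
      _ ≤ 2 ^ e * ((2 * Dm) ^ e * M) * Q ^ e := by
          refine mul_le_mul (mul_le_mul h2m' (mul_le_mul_of_nonneg_right hMe hM0) (by positivity)
            (by positivity)) hSQ (by positivity) (by positivity)
      _ = 4 ^ e * (Dm ^ e * M * Q ^ e) := by rw [mul_pow, h44]; ring

/-- **Lower bound for `t₂ = r^{m'}/s` at an arbitrary absolute value** (`e ≥ 1`):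
`max(v x, 1) · max(v s⁻¹, 1)^e ≤ 24^e · max(v t₂, 1)^e`. [cite: MochizukiGenEll2010, Prop 1.4 (i) p.6] -/
theorem tPart_lower (hem : e + 1 = 2 * m') (he : 0 < e) {x r : K}
    (hr : r ^ e = x * (1 - x)) (hs : 1 - 2 * x ≠ 0) :
    max (v x) 1 * max (v (1 - 2 * x)⁻¹) 1 ^ e ≤ (24 : ℝ) ^ e * max (v (r ^ m' / (1 - 2 * x))) 1 ^ e := by
  set X := v x with hX
  set S := v (1 - 2 * x) with hS
  set T := v (r ^ m' / (1 - 2 * x)) with hT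
  have hX0 : 0 ≤ X := v.nonneg _
  have hS0 : 0 < S := v.pos_iff.mpr hs
  have hT0 : 0 ≤ T := v.nonneg _
  have hv2le : v (2 : K) ≤ 2 := by exact_mod_cast v.apply_nat_le_self 2
  have hv20 : 0 ≤ v (2 : K) := v.nonneg _
  have hSinv : v (1 - 2 * x)⁻¹ = S⁻¹ := map_inv₀ v _
  have hm'e : m' ≤ e := by omega
  have hTe : T ^ e = (X * v (1 - x)) ^ m' / S ^ e := by rw [hT, hX, hS]; exact tPart_pow v hr
  have hTmax : T ^ e ≤ max T 1 ^ e := pow_le_pow_left₀ hT0 (le_max_left _ _) e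
  have hmax1 : 1 ≤ max T 1 ^ e := one_le_pow₀ (le_max_right _ _)
  have h24 : (1 : ℝ) ≤ 24 ^ e := one_le_pow₀ (by norm_num)
  -- numeric comparisons
  have h43 : (4 / 3 : ℝ) ^ m' ≤ 2 ^ e :=
    (pow_le_pow_left₀ (by norm_num) (by norm_num : (4/3 : ℝ) ≤ 2) m').trans
      (pow_le_pow_right₀ (by norm_num) hm'e)
  have h163 : (16 / 3 : ℝ) ^ m' ≤ 6 ^ e :=
    (pow_le_pow_left₀ (by norm_num) (by norm_num : (16/3 : ℝ) ≤ 6) m').trans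
      (pow_le_pow_right₀ (by norm_num) hm'e)
  have h2e : (2 : ℝ) ^ e ≤ 24 ^ e := pow_le_pow_left₀ (by norm_num) (by norm_num) e
  have h6e : (6 : ℝ) ^ e ≤ 24 ^ e := pow_le_pow_left₀ (by norm_num) (by norm_num) e
  have h4e : (4 : ℝ) ≤ 4 ^ e := le_self_pow₀ (by norm_num) he.ne'
  have h64 : (6 : ℝ) ^ e * 4 ≤ 24 ^ e := by
    calc (6 : ℝ) ^ e * 4 ≤ 6 ^ e * 4 ^ e := mul_le_mul_of_nonneg_left h4e (by positivity)
      _ = 24 ^ e := by rw [← mul_pow]; norm_num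
  have h34 : (4 / 3 : ℝ) ^ m' * (3 / 4) ^ m' = 1 := by rw [← mul_pow]; norm_num
  have h316 : (16 / 3 : ℝ) ^ m' * (3 / 16) ^ m' = 1 := by rw [← mul_pow]; norm_num
  -- `S ≥ 1 - v2·X`
  have hSlow : 1 - v 2 * X ≤ S := by
    have h := v.le_sub 1 (2 * x)
    rw [v.map_one, v.map_mul] at h
    rw [hS]; exact h
  rcases le_or_gt 4 X with hX4 | hX4
  · -- `X ≥ 4`
    have hX1 : 1 ≤ X := by linarith
    rw [max_eq_left hX1]
    have h1x : 3 / 4 * X ≤ v (1 - x) := by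
      have h := v.le_sub x 1
      rw [v.map_one, v.map_sub x 1] at h
      rw [hX] at hX4 ⊢; linarith
    have hnum : (3 / 4) ^ m' * (X ^ e * X) ≤ (X * v (1 - x)) ^ m' := by
      have h1 : 3 / 4 * (X * X) ≤ X * v (1 - x) := by nlinarith
      calc (3 / 4 : ℝ) ^ m' * (X ^ e * X) = (3 / 4 * (X * X)) ^ m' := by
            rw [mul_pow, mul_self_pow hem X]
        _ ≤ (X * v (1 - x)) ^ m' := pow_le_pow_left₀ (by positivity) h1 m'
    have hXeX : X ≤ X ^ e * X := le_mul_of_one_le_left hX0 (one_le_pow₀ hX1)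
    rcases le_or_gt S 1 with hS1 | hS1
    · -- `S ≤ 1`
      rw [hSinv, max_eq_left (one_le_inv_iff₀.mpr ⟨hS0, hS1⟩), inv_pow]
      have hkey : X * (S ^ e)⁻¹ ≤ (4 / 3) ^ m' * T ^ e := by
        calc X * (S ^ e)⁻¹ ≤ (X ^ e * X) * (S ^ e)⁻¹ := mul_le_mul_of_nonneg_right hXeX (by positivity)
          _ = ((4 / 3) ^ m' * (3 / 4) ^ m') * (X ^ e * X) / S ^ e := by rw [h34, one_mul, div_eq_mul_inv]
          _ = (4 / 3) ^ m' * ((3 / 4) ^ m' * (X ^ e * X) / S ^ e) := by ring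
          _ ≤ (4 / 3) ^ m' * ((X * v (1 - x)) ^ m' / S ^ e) :=
              mul_le_mul_of_nonneg_left (div_le_div_of_nonneg_right hnum (by positivity)) (by positivity)
          _ = (4 / 3) ^ m' * T ^ e := by rw [hTe]
      calc X * (S ^ e)⁻¹ ≤ (4 / 3) ^ m' * T ^ e := hkey
        _ ≤ 24 ^ e * max T 1 ^ e := mul_le_mul (h43.trans h2e) hTmax (by positivity) (by positivity)
    · -- `S > 1`: `S ≤ 3X`
      rw [hSinv, max_eq_right (inv_le_one_of_one_le₀ hS1.le), one_pow, mul_one]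
      have hS3 : S ≤ 3 * X := by
        calc S ≤ v 1 + v (2 * x) := v.sub_le_add 1 (2 * x)
          _ = 1 + v 2 * X := by rw [v.map_one, v.map_mul]
          _ ≤ 3 * X := by nlinarith
      have hXne : X ≠ 0 := by positivity
      have hkey : X ≤ (4 / 3) ^ m' * 3 ^ e * T ^ e := by
        calc X = ((4 / 3) ^ m' * (3 / 4) ^ m') * 3 ^ e * ((X ^ e * X) / (3 * X) ^ e) := by
              rw [h34, one_mul, mul_pow]; field_simp
          _ = (4 / 3) ^ m' * 3 ^ e * ((3 / 4) ^ m' * (X ^ e * X) / (3 * X) ^ e) := by ring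
          _ ≤ (4 / 3) ^ m' * 3 ^ e * ((X * v (1 - x)) ^ m' / (3 * X) ^ e) :=
              mul_le_mul_of_nonneg_left (div_le_div_of_nonneg_right hnum (by positivity)) (by positivity)
          _ ≤ (4 / 3) ^ m' * 3 ^ e * ((X * v (1 - x)) ^ m' / S ^ e) :=
              mul_le_mul_of_nonneg_left (div_le_div_of_nonneg_left (by positivity) (by positivity)
                (pow_le_pow_left₀ hS0.le hS3 e)) (by positivity)
          _ = (4 / 3) ^ m' * 3 ^ e * T ^ e := by rw [hTe]
      have hconst : (4 / 3 : ℝ) ^ m' * 3 ^ e ≤ 24 ^ e := by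
        calc (4 / 3 : ℝ) ^ m' * 3 ^ e ≤ 2 ^ e * 3 ^ e := mul_le_mul_of_nonneg_right h43 (by positivity)
          _ = 6 ^ e := by rw [← mul_pow]; norm_num
          _ ≤ 24 ^ e := h6e
      calc X ≤ (4 / 3) ^ m' * 3 ^ e * T ^ e := hkey
        _ ≤ 24 ^ e * max T 1 ^ e := mul_le_mul hconst hTmax (by positivity) (by positivity)
  · rcases le_or_gt X (1 / 4) with hX14 | hX14
    · -- `X ≤ 1/4`: `S ≥ 1/2`
      have hS12 : 1 / 2 ≤ S := by nlinarith
      rw [max_eq_right (by linarith : X ≤ 1), one_mul, hSinv]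
      have hQ : max S⁻¹ 1 ≤ 2 :=
        max_le (by rw [inv_le_comm₀ hS0 (by norm_num)]; linarith) (by norm_num)
      calc max S⁻¹ 1 ^ e ≤ 2 ^ e := pow_le_pow_left₀ (by positivity) hQ e
        _ = 2 ^ e * 1 := (mul_one _).symm
        _ ≤ 24 ^ e * max T 1 ^ e := mul_le_mul h2e hmax1 zero_le_one (by positivity)
    · -- `1/4 < X < 4`
      have hM4 : max X 1 ≤ 4 := max_le hX4.le (by norm_num)
      rcases le_or_gt (1 / 2) S with hS12 | hS12
      · have hQ : max (v (1 - 2 * x)⁻¹) 1 ≤ 2 :=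
          max_le (by rw [hSinv, inv_le_comm₀ hS0 (by norm_num)]; linarith) (by norm_num)
        calc max X 1 * max (v (1 - 2 * x)⁻¹) 1 ^ e ≤ 4 * 2 ^ e :=
              mul_le_mul hM4 (pow_le_pow_left₀ (by positivity) hQ e) (by positivity) (by norm_num)
          _ ≤ 6 ^ e * 4 := by
              rw [mul_comm]
              exact mul_le_mul_of_nonneg_right (pow_le_pow_left₀ (by norm_num) (by norm_num) e)
                (by norm_num)
          _ ≤ 24 ^ e * 1 := by rw [mul_one]; exact h64
          _ ≤ 24 ^ e * max T 1 ^ e := mul_le_mul_of_nonneg_left hmax1 (by positivity)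
      · -- Weierstrass region: `S < 1/2`, `v(x(1-x)) ≥ 3/16`
        rw [hSinv, max_eq_left ((one_le_inv_iff₀.mpr ⟨hS0, by linarith⟩))]
        have hprod : 3 / 16 ≤ X * v (1 - x) := by
          have h := quarter_le v x
          rw [v.map_mul] at h
          rw [hX]
          nlinarith
        have hnum : (3 / 16 : ℝ) ^ m' ≤ (X * v (1 - x)) ^ m' :=
          pow_le_pow_left₀ (by norm_num) hprod m'
        have hkey : (S⁻¹) ^ e ≤ (16 / 3) ^ m' * T ^ e := by
          rw [inv_pow]
          calc (S ^ e)⁻¹ = ((16 / 3) ^ m' * (3 / 16) ^ m') / S ^ e := by rw [h316, one_div]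
            _ = (16 / 3) ^ m' * ((3 / 16) ^ m' / S ^ e) := by ring
            _ ≤ (16 / 3) ^ m' * ((X * v (1 - x)) ^ m' / S ^ e) :=
                mul_le_mul_of_nonneg_left (div_le_div_of_nonneg_right hnum (by positivity))
                  (by positivity)
            _ = (16 / 3) ^ m' * T ^ e := by rw [hTe]
        calc max X 1 * S⁻¹ ^ e ≤ 4 * ((16 / 3) ^ m' * T ^ e) :=
              mul_le_mul hM4 hkey (by positivity) (by norm_num)
          _ = ((16 / 3) ^ m' * 4) * T ^ e := by ring
          _ ≤ (6 ^ e * 4) * max T 1 ^ e :=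
              mul_le_mul (mul_le_mul_of_nonneg_right h163 (by norm_num)) hTmax (by positivity)
                (by positivity)
          _ ≤ 24 ^ e * max T 1 ^ e := mul_le_mul_of_nonneg_right h64 (by positivity)

/-- **Disjoint polar parts of `t₁ = 1/r` and `t₂ = r^{m'}/s`, at an arbitrary absolute value**
(`e ≥ 2`): `max(v t₁, 1) · max(v t₂, 1) ≤ 32 · max(v(t₁ + t₂), 1)` — `v t₁ ≥ 4` forces `v s ≥ 1/2`
and `v t₂ ≤ 1/2`; `v t₂ ≥ 8` forces `v t₁ < 4`. [cite: MochizukiGenEll2010, Prop 1.4 (i) p.6] -/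
theorem tSum_lower (hem : e + 1 = 2 * m') (he : 2 ≤ e) {x r : K} (hr : r ^ e = x * (1 - x))
    (hr0 : r ≠ 0) (hs : 1 - 2 * x ≠ 0) :
    max (v r⁻¹) 1 * max (v (r ^ m' / (1 - 2 * x))) 1 ≤ 32 * max (v (r⁻¹ + r ^ m' / (1 - 2 * x))) 1 := by
  set X := v x with hX
  set S := v (1 - 2 * x) with hS
  set R := v r with hR
  set T := v (r ^ m' / (1 - 2 * x)) with hT
  have hX0 : 0 ≤ X := v.nonneg _
  have hR0 : 0 < R := v.pos_iff.mpr hr0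
  have hS0 : 0 < S := v.pos_iff.mpr hs
  have hT0 : 0 ≤ T := v.nonneg _
  have hv2le : v (2 : K) ≤ 2 := by exact_mod_cast v.apply_nat_le_self 2
  have hv20 : 0 ≤ v (2 : K) := v.nonneg _
  have hm'1 : 1 ≤ m' := by omega
  have ht1 : v r⁻¹ = R⁻¹ := map_inv₀ v r
  have hTdef : T = R ^ m' / S := by rw [hT, map_div₀, v.map_pow]
  have hRe : R ^ e = X * v (1 - x) := by rw [hR, ← v.map_pow, hr, v.map_mul]
  have hW1 : 1 ≤ max (v (r⁻¹ + r ^ m' / (1 - 2 * x))) 1 := le_max_right _ _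
  have hWv : v (r⁻¹ + r ^ m' / (1 - 2 * x)) ≤ max (v (r⁻¹ + r ^ m' / (1 - 2 * x))) 1 := le_max_left _ _
  -- key: `R ≤ 1/4 ⟹ T ≤ 1/2`
  have hkey : R ≤ 1 / 4 → T ≤ 1 / 2 := by
    intro hR4
    have hR1 : R ≤ 1 := hR4.trans (by norm_num)
    have hRe16 : X * v (1 - x) ≤ 1 / 16 := by
      rw [← hRe]
      calc R ^ e ≤ R ^ 2 := pow_le_pow_of_le_one hR0.le hR1 he
        _ ≤ (1 / 4) ^ 2 := pow_le_pow_left₀ hR0.le hR4 2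
        _ = 1 / 16 := by norm_num
    have hS12 : 1 / 2 ≤ S := by
      rcases le_or_gt X (1 / 4) with hX4 | hX4
      · have h := v.le_sub 1 (2 * x)
        rw [v.map_one, v.map_mul] at h
        rw [hS]; nlinarith
      · have h1x : v (1 - x) < 1 / 4 := by
          by_contra hcon
          push Not at hcon
          nlinarith
        have h := v.le_sub 1 (2 * (1 - x))
        rw [v.map_one, v.map_mul, show (1 : K) - 2 * (1 - x) = -(1 - 2 * x) by ring, v.map_neg] at h
        rw [hS]; nlinarith
    have hRm : R ^ m' ≤ R := by
      calc R ^ m' ≤ R ^ 1 := pow_le_pow_of_le_one hR0.le hR1 hm'1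
        _ = R := pow_one R
    rw [hTdef, div_le_iff₀ hS0]
    nlinarith
  rcases le_or_gt R (1 / 4) with hR4 | hR4
  · -- `v t₁ ≥ 4`, `v t₂ ≤ 1/2`
    have hT12 : T ≤ 1 / 2 := hkey hR4
    have ht14 : 4 ≤ v r⁻¹ := by
      rw [ht1, le_inv_comm₀ (by norm_num) hR0]; linarith
    have hsum : v r⁻¹ - T ≤ v (r⁻¹ + r ^ m' / (1 - 2 * x)) := v.le_add _ _
    rw [max_eq_left (by linarith : (1 : ℝ) ≤ v r⁻¹), max_eq_right (by linarith : T ≤ 1), mul_one]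
    linarith
  · -- `v t₁ < 4`
    have ht14 : v r⁻¹ < 4 := by
      rw [ht1, inv_lt_comm₀ hR0 (by norm_num)]; linarith
    have hmax4 : max (v r⁻¹) 1 ≤ 4 := max_le ht14.le (by norm_num)
    rcases le_or_gt 8 T with hT8 | hT8
    · have hsum : T - v r⁻¹ ≤ v (r⁻¹ + r ^ m' / (1 - 2 * x)) := by
        rw [add_comm]; exact v.le_add _ _
      rw [max_eq_left (by linarith : (1 : ℝ) ≤ T)]
      nlinarith
    · have hmaxT : max T 1 ≤ 8 := max_le hT8.le (by norm_num)
      calc max (v r⁻¹) 1 * max T 1 ≤ 4 * 8 := mul_le_mul hmax4 hmaxT (by positivity) (by norm_num)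
        _ = 32 * 1 := by norm_num
        _ ≤ 32 * max (v (r⁻¹ + r ^ m' / (1 - 2 * x))) 1 := by gcongr

end Local

end Superelliptic

end Literature.NumberTheory.DiophantineGeometry

end
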